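import Mathlib
import HarnessLib

/-!
# Tuck's incompressibility function and the Berry–Shukla example

For a function `D` real on the real axis and analytic near it,
`|D(x+iy)|² = D(x)² + y² (D'(x)² - D(x) D''(x)) + O(y⁴)`; if the coefficient of `y²` is positive
there are no complex zeros in the immediate neighbourhood of the real axis, which led E. O. Tuck to
study it (normalised) numerically for Riemann's `ξ` on the critical line. Berry and Shukla
[cite: BerryShukla2008, §1 eqs. (1.1)–(1.4)] study the reciprocal normalisation, *Tuck's
incompressibility function* `Q(x) = D'(x)² / (D'(x)² - D(x) D''(x))`, and list five elementary
observations; the second, third and fifth are formalised here for POLYNOMIAL `D` (where `D'` is the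
formal derivative):

* (second) `Q` vanishes at the critical points of `D` (`tuckQ_eq_zero_of_deriv_eq_zero`);
* (third) `Q(x₀) = 1` at a simple zero `x₀` of `D` (`tuckQ_eq_one_of_simple_zero`);
* (fifth — the no-go remark) "positivity of `Q(x)` does not guarantee the absence of complex zeros
  that are not close to the real axis; this is illustrated by `D(x, a) = (x² - 1)(x² + a²)` (1.4),
  for which `Q(x)` is positive for all real `x` if `a > 1` … Therefore Tuck's computations for `ζ`
  … should not be interpreted as implying that the Riemann hypothesis is true"
  [cite: BerryShukla2008, §1, fifth observation and eq. (1.4)]: `berryShukla_example` proves, for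
  `a > 1`, that `±ia` are (non-real) zeros of `D(·, a)`, that the `y²`-coefficient
  `D'² - D D''` is positive at EVERY real `x` (closed form
  `4x⁶ + 2(a²-1)x⁴ + (2(a²-1)² + 12a²)x² + 2a²(a²-1)`), hence `Q(x) > 0` for all real `x ≠ 0`
  and `Q(0) = 0` (precise form of the printed "positive for all real x": `x = 0` is a critical
  point of `D`, where `Q` vanishes by the second observation).

Everything is proved; no named facts. (Motivation: RH construction census, tradition t8, where the
remark is recorded as a printed no-go against "local convexity / phase statistics on the critical
line ⟹ RH" readings — construction census at finite level; no RH claim.)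
-/

noncomputable section

namespace Literature.NumberTheory.LFunctions

open Polynomial

namespace Tuck

/-- The `y²`-coefficient of `|D(x+iy)|²` for a real polynomial `D`: the polynomial
`D'² - D·D''` [cite: BerryShukla2008, §1 eqs. (1.1)–(1.2)]. -/
def yySqCoeff (D : ℝ[X]) : ℝ[X] := derivative D ^ 2 - D * derivative (derivative D)

/-- Tuck's incompressibility function `Q(x) = D'(x)² / (D'(x)² - D(x) D''(x))` of a real
polynomial `D` (junk value `0` where the denominator vanishes, Lean's `x / 0 = 0`).
[cite: BerryShukla2008, §1 eq. (1.2)] -/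
def tuckQ (D : ℝ[X]) (x : ℝ) : ℝ := (derivative D).eval x ^ 2 / (yySqCoeff D).eval x

/-- Second observation of [cite: BerryShukla2008, §1]: `Q` vanishes at the critical points of `D`. -/
theorem tuckQ_eq_zero_of_deriv_eq_zero (D : ℝ[X]) {x : ℝ} (hx : (derivative D).eval x = 0) :
    tuckQ D x = 0 := by
  simp [tuckQ, hx]

/-- Third observation of [cite: BerryShukla2008, §1]: `Q(x₀) = 1` at a simple zero `x₀` of `D`. -/
theorem tuckQ_eq_one_of_simple_zero (D : ℝ[X]) {x : ℝ} (hx : D.eval x = 0)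
    (hx' : (derivative D).eval x ≠ 0) : tuckQ D x = 1 := by
  have h : (yySqCoeff D).eval x = (derivative D).eval x ^ 2 := by
    simp [yySqCoeff, hx]
  rw [tuckQ, h, div_self (pow_ne_zero 2 hx')]

/-- The Berry–Shukla polynomial `D(x, a) = (x² - 1)(x² + a²)` [cite: BerryShukla2008, eq. (1.4)]. -/
def bsPoly (a : ℝ) : ℝ[X] := (X ^ 2 - 1) * (X ^ 2 + C (a ^ 2))

/-- Closed form of the `y²`-coefficient for the Berry–Shukla polynomial:
`D'² - D D'' = 4x⁶ + 2(a²-1)x⁴ + (2(a²-1)² + 12a²)x² + 2a²(a²-1)`. [cite: BerryShukla2008, eq. (1.4)] -/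
theorem eval_yySqCoeff_bsPoly (a x : ℝ) :
    (yySqCoeff (bsPoly a)).eval x
      = 4 * x ^ 6 + 2 * (a ^ 2 - 1) * x ^ 4 + (2 * (a ^ 2 - 1) ^ 2 + 12 * a ^ 2) * x ^ 2
        + 2 * a ^ 2 * (a ^ 2 - 1) := by
  simp [yySqCoeff, bsPoly, derivative_mul, derivative_pow]
  ring

/-- **Berry–Shukla's example** [cite: BerryShukla2008, §1, fifth observation, eq. (1.4)]: for
`a > 1` the polynomial `D(x,a) = (x² - 1)(x² + a²)` has the non-real zeros `±ia`, yet the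
`y²`-coefficient `D'² - D D''` is positive at every real point, so Tuck's `Q` is `> 0` at every
real `x ≠ 0` (and `Q(0) = 0`, `x = 0` being a critical point): positivity of `Q` along the real
axis does not exclude complex zeros away from it. -/
theorem berryShukla_example (a : ℝ) (ha : 1 < a) :
    (aeval (Complex.I * a) (bsPoly a) = 0 ∧ aeval (-(Complex.I * a)) (bsPoly a) = 0) ∧
    (∀ x : ℝ, 0 < (yySqCoeff (bsPoly a)).eval x) ∧
    (∀ x : ℝ, x ≠ 0 → 0 < tuckQ (bsPoly a) x) ∧ tuckQ (bsPoly a) 0 = 0 := by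
  have ha2 : 0 < a ^ 2 - 1 := by nlinarith
  have hpos : ∀ x : ℝ, 0 < (yySqCoeff (bsPoly a)).eval x := by
    intro x
    rw [eval_yySqCoeff_bsPoly]
    nlinarith [sq_nonneg (x ^ 3), mul_nonneg ha2.le (sq_nonneg (x ^ 2)),
      sq_nonneg (x * (a ^ 2 - 1)), sq_nonneg (a * x), mul_pos (by positivity : (0 : ℝ) < a ^ 2) ha2]
  have hder : ∀ x : ℝ, (derivative (bsPoly a)).eval x = 2 * x * (2 * x ^ 2 + (a ^ 2 - 1)) := by
    intro x
    simp [bsPoly, derivative_mul, derivative_pow]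
    ring
  refine ⟨⟨?_, ?_⟩, hpos, ?_, ?_⟩
  · simp only [bsPoly, map_mul, map_sub, map_add, map_pow, aeval_X, aeval_C, map_one,
      Complex.coe_algebraMap]
    ring_nf
    simp [Complex.I_sq]
  · simp only [bsPoly, map_mul, map_sub, map_add, map_pow, aeval_X, aeval_C, map_one,
      Complex.coe_algebraMap]
    ring_nf
    simp [Complex.I_sq]
  · intro x hx
    rw [tuckQ]
    refine div_pos ?_ (hpos x)
    rw [hder]
    have : 2 * x * (2 * x ^ 2 + (a ^ 2 - 1)) ≠ 0 := by
      refine mul_ne_zero (mul_ne_zero two_ne_zero hx) ?_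
      nlinarith [sq_nonneg x]
    positivity
  · exact tuckQ_eq_zero_of_deriv_eq_zero _ (by rw [hder]; ring)

end Tuck

end Literature.NumberTheory.LFunctions
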